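import Summits.Ventures.YMGap.FlowData.RectTubeLogNormSecondOrder
import Summits.Ventures.YMGap.FlowData.RectTubeStepExponentMoments
import Summits.Ventures.YMGap.FlowData.RectTubeOneSitePlaquetteCovariance
import Summits.Ventures.YMGap.FlowData.RectTubeMagneticTwistParity
import HarnessLib

/-!
# Venture YMGap, track Y3 FLOW-DATA — THE SECOND-ORDER STRONG-COUPLING LAW OF THE MAGNETIC-FLUX ENERGY:
# `ln λ₀(ζ) = J·E[M_ζ] + (J²/2)·Var(M_ζ) + (J²/2)·E[elec²] + O(J³)` when the representation has no invariant vector, hence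
# `E_mag(β; Λ; S) = (β/2)(E[M₁] − E[M_S]) + (β²/8)(Var M₁ − Var M_S) + O(β³)` for `SU(2)` (theorems only)

HONEST FRAMING: venture file of the cell `pub-ymgap` (QuantumFields programme), track Y3 (FLOW-DATA); companion THEOREMS for
`FlowData/RectTubeLogNormSecondOrder.lean` (the generic law `ln‖T_ζ‖ = J m₁ + (J²/2)(m₂ − m₁²) + J² V + O(J³)`).  Here the
three moments are computed: when `∫ Re tr ρ(C g D) dg = 0` for all `C, D` (no invariant vector — e.g. `SU(2)` fundamental) the
temporal plaquette sum `elec` integrates to zero in the earlier AND in the later slice separately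
(`integral_rectElecSum_later_eq_zero`, `integral_rectElecSum_earlier_eq_zero`), so with the twisted magnetic sum
`M_ζ = magTw_ζ` on one slice (probability Haar measure):

* `rowMean_stepExponent_eq` — `∫_b∫_E Φ_ζ(a,E,b) = M_ζ(a)/2 + E[M_ζ]/2`;
* `mean_stepExponent_eq` (`m₁ = E[M_ζ]`), `rowVariance_stepExponent_eq` (`V = ¼ Var M_ζ`),
  `sqMean_stepExponent_eq` (`m₂ = ½ E[M_ζ²] + ½ E[M_ζ]² + E[elec²]`);
* **`abs_log_norm_rectTubeTwistedOperator_sub_moments_le`** — `|ln‖T_ζ‖ − (J E[M_ζ] + (J²/2) Var M_ζ + (J²/2) E[elec²])| ≤ 100 u³`,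
  `u = |J| n (3#P+N) ≤ 1/8`;
* the cell's `SU(2)` objects: `su2_integral_re_trace_mul_mul_eq_zero` (`∫ Re tr(C g D) dg = 0`), and
  **`abs_su2RectMagneticFluxEnergy_sub_secondOrder_le`** —
  `|E_mag(β; Λ; S) − ((β/2)(E[M₁] − E[M_S]) + (β²/8)(Var M₁ − Var M_S))| ≤ 200 (|β|(3#P+N))³` for `|β|(3#P+N) ≤ 1/8`,
  `M₁ = Σ_q Re tr U_q`, `M_S` the same with the plaquettes of `S` sign-flipped: the `E[elec²]` terms CANCEL, and the `β²`
  coefficient of `E_mag` is a difference of VARIANCES of one-slice plaquette sums — on the one-site tori of the FLOW-TABLE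
  it evaluates to `(k−2)/4` (`FlowData/RectTubeMagneticOneSiteSecondOrder.lean`), i.e. `0` for `d = 3` (done here:
  `abs_su2RectMagneticFluxEnergy_oneSite_two_sub_le`, `M_S = −M₁` on the one-site `2`-torus) and `¼` for `d = 4`.

Finite tubes, small `β`; nothing about `L → ∞`, the continuum or a mass gap; no number of the FLOW-TABLE.

References: T. Kato (1966) §II.2 [cite: Kato1966, §II.2]; I. Montvay, G. Münster (1994) §3.2.6 [cite: MontvayMunster1994, §3.2.6];
G. 't Hooft, Nucl. Phys. B 153 (1979) 141 [cite: tHooft1979Flux].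
-/

noncomputable section

open scoped BigOperators ENNReal InnerProductSpace
open MeasureTheory Filter Function Topology
open Literature.MathematicalPhysics.QuantumFieldTheory Literature.Analysis.OperatorTheory
open Literature.MathematicalPhysics.QuantumLattice (RectTorusSite fundamentalRep continuous_fundamentalRep
  fundamentalRep_mem_unitaryGroup)
open Literature.Barriers.QuantumFields
open Summit.Ventures.YMGap.Census (RectPlaquette rectPlaquetteHolonomy)
open Summit.Ventures.LatticeQCDFlow.Exactness Summit.Ventures.LatticeQCDFlow.Scoring

namespace Summit.Ventures.YMGap.FlowData

section Moments

variable {G : Type*} [Group G] [TopologicalSpace G] [IsTopologicalGroup G] [CompactSpace G]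
  [MeasurableSpace G] [BorelSpace G] [SecondCountableTopology G] {n k : ℕ} (ρ : G →* Matrix (Fin n) (Fin n) ℂ)
  (J : ℝ) {Ls : Fin k → ℕ} [∀ i, NeZero (Ls i)]

/-- **THE SECOND-ORDER LAW IN MOMENT FORM**: when `∫ Re tr ρ(C g D) dg = 0` (no invariant vector) and `u = |J| n(3#P+N) ≤ 1/8`,
`|ln ‖T_ζ‖ − (J·E[M_ζ] + (J²/2)·Var(M_ζ) + (J²/2)·∫∫∫ elec²)| ≤ 100 u³` with `M_ζ = magTw_ζ` the (twisted) magnetic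
plaquette sum of ONE slice under the product Haar measure. [cite: Kato1966, §II.2] -/
theorem abs_log_norm_rectTubeTwistedOperator_sub_moments_le (hρ : Continuous ρ)
    (hρu : ∀ g, ρ g ∈ Matrix.unitaryGroup (Fin n) ℂ)
    (hρ0 : ∀ C D : G, ∫ g, (ρ (C * g * D)).trace.re ∂(haarProbability G) = 0) (ζ : RectPlaquette Ls → G)
    (hJ : |J| * (n * (3 * (Fintype.card (RectTorusSite Ls) * Fintype.card {p : Fin k × Fin k // p.1 < p.2}) +
        Fintype.card (RectTorusSite Ls × Fin k))) ≤ 1 / 8) :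
    |Real.log ‖rectTubeTwistedOperator ρ J Ls ζ‖ -
        (J * (∫ a, rectMagSumTw ρ ζ a ∂(rectSliceMeasure G Ls)) +
          J ^ 2 / 2 * (∫ a, (rectMagSumTw ρ ζ a - ∫ b, rectMagSumTw ρ ζ b ∂(rectSliceMeasure G Ls)) ^ 2
            ∂(rectSliceMeasure G Ls)) +
          J ^ 2 / 2 * ∫ a, ∫ b, ∫ E, rectElecSum ρ a E b ^ 2 ∂(Measure.pi fun _ : RectTorusSite Ls => haarProbability G)
            ∂(rectSliceMeasure G Ls) ∂(rectSliceMeasure G Ls))| ≤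
      100 * (|J| * (n * (3 * (Fintype.card (RectTorusSite Ls) * Fintype.card {p : Fin k × Fin k // p.1 < p.2}) +
        Fintype.card (RectTorusSite Ls × Fin k)))) ^ 3 := by
  have h := abs_log_norm_rectTubeTwistedOperator_sub_le ρ J hρ hρu ζ hJ
  rw [rowVariance_stepExponent_eq ρ hρ hρ0 ζ, sqMean_stepExponent_eq ρ hρ hρ0 ζ, mean_stepExponent_eq ρ hρ hρ0 ζ,
    integral_sub_mean_sq_eq ρ hρ ζ] at h
  rw [integral_sub_mean_sq_eq ρ hρ ζ]
  have e : J * (∫ a, rectMagSumTw ρ ζ a ∂(rectSliceMeasure G Ls)) +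
      J ^ 2 / 2 * ((1 / 2) * (∫ a, rectMagSumTw ρ ζ a ^ 2 ∂(rectSliceMeasure G Ls)) +
        (1 / 2) * (∫ a, rectMagSumTw ρ ζ a ∂(rectSliceMeasure G Ls)) ^ 2 +
        (∫ a, ∫ b, ∫ E, rectElecSum ρ a E b ^ 2 ∂(Measure.pi fun _ : RectTorusSite Ls => haarProbability G)
          ∂(rectSliceMeasure G Ls) ∂(rectSliceMeasure G Ls)) -
        (∫ a, rectMagSumTw ρ ζ a ∂(rectSliceMeasure G Ls)) ^ 2) +
      J ^ 2 * ((1 / 4) * ((∫ a, rectMagSumTw ρ ζ a ^ 2 ∂(rectSliceMeasure G Ls)) -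
        (∫ b, rectMagSumTw ρ ζ b ∂(rectSliceMeasure G Ls)) ^ 2)) =
      J * (∫ a, rectMagSumTw ρ ζ a ∂(rectSliceMeasure G Ls)) +
        J ^ 2 / 2 * ((∫ a, rectMagSumTw ρ ζ a ^ 2 ∂(rectSliceMeasure G Ls)) -
          (∫ b, rectMagSumTw ρ ζ b ∂(rectSliceMeasure G Ls)) ^ 2) +
        J ^ 2 / 2 * ∫ a, ∫ b, ∫ E, rectElecSum ρ a E b ^ 2 ∂(Measure.pi fun _ : RectTorusSite Ls => haarProbability G)
          ∂(rectSliceMeasure G Ls) ∂(rectSliceMeasure G Ls) := by ring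
  rw [e] at h
  exact h

end Moments

/-! ### The cell's objects: `SU(2)`, fundamental representation -/

section SU2

variable {k : ℕ} {Ls : Fin k → ℕ} [∀ i, NeZero (Ls i)]

/-- **THE SECOND-ORDER STRONG-COUPLING LAW OF THE MAGNETIC-FLUX ENERGY** (`SU(2)`, fundamental, Wilson coupling `β`, any
rectangular cross-section `Λ = Π ℤ/Lᵢ`, any twisted plaquette set `S`): with `M₁ = Σ_q Re tr U_q` the magnetic plaquette sum of
one slice, `M_S` the same sum with the plaquettes of `S` entering as `Re tr(−U_q)`, expectations under the product Haar measure,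
and `|β| (3#P + N) ≤ 1/8`:
`|E_mag(β; Λ; S) − ((β/2)(E[M₁] − E[M_S]) + (β²/8)(Var M₁ − Var M_S))| ≤ 200 (|β|(3#P + N))³`.
The `E[elec²]` contributions of the two operators cancel: the `β²` coefficient of `E_mag` is one eighth of a DIFFERENCE OF
VARIANCES of one-slice plaquette sums. [cite: Kato1966, §II.2] [cite: tHooft1979Flux] -/
theorem abs_su2RectMagneticFluxEnergy_sub_secondOrder_le (β : ℝ) (Ls : Fin k → ℕ) [∀ i, NeZero (Ls i)]
    (S : Finset (RectPlaquette Ls))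
    (hβ : |β| * (3 * (Fintype.card (RectTorusSite Ls) * Fintype.card {p : Fin k × Fin k // p.1 < p.2}) +
        Fintype.card (RectTorusSite Ls × Fin k)) ≤ 1 / 8) :
    |su2RectMagneticFluxEnergy β Ls S -
        (β / 2 * ((∫ a, rectMagSumTw (fundamentalRep (Fin 2)) 1 a
              ∂(rectSliceMeasure (Matrix.specialUnitaryGroup (Fin 2) ℂ) Ls)) -
            ∫ a, rectMagSumTw (fundamentalRep (Fin 2)) (su2PlaquetteTwist S) a
              ∂(rectSliceMeasure (Matrix.specialUnitaryGroup (Fin 2) ℂ) Ls)) +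
          β ^ 2 / 8 * ((∫ a, (rectMagSumTw (fundamentalRep (Fin 2)) 1 a -
                ∫ b, rectMagSumTw (fundamentalRep (Fin 2)) 1 b ∂(rectSliceMeasure (Matrix.specialUnitaryGroup (Fin 2) ℂ) Ls)) ^ 2
                ∂(rectSliceMeasure (Matrix.specialUnitaryGroup (Fin 2) ℂ) Ls)) -
            ∫ a, (rectMagSumTw (fundamentalRep (Fin 2)) (su2PlaquetteTwist S) a -
                ∫ b, rectMagSumTw (fundamentalRep (Fin 2)) (su2PlaquetteTwist S) b
                  ∂(rectSliceMeasure (Matrix.specialUnitaryGroup (Fin 2) ℂ) Ls)) ^ 2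
                ∂(rectSliceMeasure (Matrix.specialUnitaryGroup (Fin 2) ℂ) Ls)))| ≤
      200 * (|β| * (3 * (Fintype.card (RectTorusSite Ls) * Fintype.card {p : Fin k × Fin k // p.1 < p.2}) +
        Fintype.card (RectTorusSite Ls × Fin k))) ^ 3 := by
  haveI : SecondCountableTopology (Matrix.specialUnitaryGroup (Fin 2) ℂ) :=
    Literature.MathematicalPhysics.QuantumLattice.secondCountableTopology_su2
  set ρ := fundamentalRep (Fin 2) with hρdef
  have hρ : Continuous ρ := continuous_fundamentalRep (Fin 2)
  have hρu : ∀ g, ρ g ∈ Matrix.unitaryGroup (Fin 2) ℂ := fundamentalRep_mem_unitaryGroup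
  have hρ0 : ∀ C D : Matrix.specialUnitaryGroup (Fin 2) ℂ,
      ∫ g, ((ρ (C * g * D)).trace).re ∂haarProbability (Matrix.specialUnitaryGroup (Fin 2) ℂ) = 0 :=
    su2_integral_re_trace_mul_mul_eq_zero
  set c : ℝ := (3 * (Fintype.card (RectTorusSite Ls) * Fintype.card {p : Fin k × Fin k // p.1 < p.2}) +
        Fintype.card (RectTorusSite Ls × Fin k)) with hc
  have hc0 : 0 ≤ c := by positivity
  have hJ : |β / 2| * ((2 : ℕ) * (3 * (Fintype.card (RectTorusSite Ls) * Fintype.card {p : Fin k × Fin k // p.1 < p.2}) +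
        Fintype.card (RectTorusSite Ls × Fin k))) ≤ 1 / 8 := by
    rw [abs_div, abs_two]
    push_cast
    linarith
  have hu : |β / 2| * ((2 : ℕ) * (3 * (Fintype.card (RectTorusSite Ls) * Fintype.card {p : Fin k × Fin k // p.1 < p.2}) +
        Fintype.card (RectTorusSite Ls × Fin k))) = |β| * c := by
    rw [abs_div, abs_two, hc]
    push_cast
    ring
  have h1 := abs_log_norm_rectTubeTwistedOperator_sub_moments_le ρ (β / 2) (Ls := Ls) hρ hρu hρ0 1 hJ
  have hS := abs_log_norm_rectTubeTwistedOperator_sub_moments_le ρ (β / 2) (Ls := Ls) hρ hρu hρ0 (su2PlaquetteTwist S) hJ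
  rw [hu] at h1 hS
  -- `E_mag = log ‖T_1‖ − log ‖T_S‖`
  have hE : su2RectMagneticFluxEnergy β Ls S =
      Real.log ‖rectTubeTwistedOperator ρ (β / 2) Ls 1‖ -
        Real.log ‖rectTubeTwistedOperator ρ (β / 2) Ls (su2PlaquetteTwist S)‖ := by
    unfold su2RectMagneticFluxEnergy rectMagneticFluxEnergy
    rw [rectTubeTwistedOperator_one hρ]
  rw [hE]
  obtain ⟨h1l, h1u⟩ := abs_le.1 h1
  obtain ⟨hSl, hSu⟩ := abs_le.1 hS
  rw [show β ^ 2 / 8 = (β / 2) ^ 2 / 2 by ring]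
  exact abs_le.2 ⟨by linarith, by linarith⟩

end SU2

/-! ### The one-site `2`-torus of the FLOW-TABLE (`d = 3`): no `β²` term -/

section AnyTorus

variable {k : ℕ} {Ls : Fin k → ℕ} [∀ i, NeZero (Ls i)]

/-- **`E[M₁] − E[M_S] = 2·E[Σ_{q∈S} Re tr U_q]`** on every rectangular torus (`SU(2)`: twisting flips the sign of the twisted
plaquettes' traces). [folklore] -/
theorem su2_integral_rectMagSumTw_one_sub_eq (S : Finset (RectPlaquette Ls)) :
    (∫ a, rectMagSumTw (fundamentalRep (Fin 2)) 1 a ∂(rectSliceMeasure (Matrix.specialUnitaryGroup (Fin 2) ℂ) Ls)) -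
        ∫ a, rectMagSumTw (fundamentalRep (Fin 2)) (su2PlaquetteTwist S) a
          ∂(rectSliceMeasure (Matrix.specialUnitaryGroup (Fin 2) ℂ) Ls) =
      2 * ∫ a, (∑ q ∈ S, (fundamentalRep (Fin 2) (rectPlaquetteHolonomy a q.1 q.2.1.1 q.2.1.2)).trace.re)
        ∂(rectSliceMeasure (Matrix.specialUnitaryGroup (Fin 2) ℂ) Ls) := by
  haveI : SecondCountableTopology (Matrix.specialUnitaryGroup (Fin 2) ℂ) :=
    Literature.MathematicalPhysics.QuantumLattice.secondCountableTopology_su2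
  have hc1 : Continuous (rectMagSumTw (Ls := Ls) (fundamentalRep (Fin 2)) 1) :=
    continuous_rectMagSumTw _ (continuous_fundamentalRep (Fin 2)) _
  have hcS : Continuous (rectMagSumTw (Ls := Ls) (fundamentalRep (Fin 2)) (su2PlaquetteTwist S)) :=
    continuous_rectMagSumTw _ (continuous_fundamentalRep (Fin 2)) _
  rw [← integral_sub (hc1.integrable_of_hasCompactSupport (HasCompactSupport.of_compactSpace _))
    (hcS.integrable_of_hasCompactSupport (HasCompactSupport.of_compactSpace _)), ← integral_const_mul]
  refine integral_congr_ae (ae_of_all _ fun a => ?_)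
  beta_reduce
  rw [rectMagSumTw_one]
  exact su2_rectMagSum_sub_rectMagSumTw S a

end AnyTorus

section OneSite

variable {k : ℕ}

/-- **`E[M₁] − E[M_S] = #S` on the one-site torus `1^k`** (every plaquette has Haar mean `½`). [cite: MontvayMunster1994, §3.2.6] -/
theorem su2_integral_rectMagSumTw_one_sub_oneSite (S : Finset (RectPlaquette (fun _ : Fin k => 1))) :
    (∫ a, rectMagSumTw (fundamentalRep (Fin 2)) 1 a
        ∂(rectSliceMeasure (Matrix.specialUnitaryGroup (Fin 2) ℂ) (fun _ : Fin k => 1))) -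
        ∫ a, rectMagSumTw (fundamentalRep (Fin 2)) (su2PlaquetteTwist S) a
          ∂(rectSliceMeasure (Matrix.specialUnitaryGroup (Fin 2) ℂ) (fun _ : Fin k => 1)) = S.card := by
  rw [su2_integral_rectMagSumTw_one_sub_eq S, su2_integral_plaquetteLoad_oneSite S]
  ring

/-- **On the one-site `2`-torus there is exactly one plaquette, so twisting it gives `M_S = −M₁` pointwise.** [folklore] -/
theorem rectMagSumTw_twist_eq_neg_oneSite_two (p : RectPlaquette (fun _ : Fin 2 => 1))
    (a : RectSlice (fun _ : Fin 2 => 1) (Matrix.specialUnitaryGroup (Fin 2) ℂ)) :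
    rectMagSumTw (fundamentalRep (Fin 2)) (su2PlaquetteTwist {p}) a = -rectMagSumTw (fundamentalRep (Fin 2)) 1 a := by
  classical
  -- every plaquette is `p`
  have hall : ∀ q : RectPlaquette (fun _ : Fin 2 => 1), q = p := fun q => by
    rw [plaq2_eq p q]
    have h1 : q.1 = p.1 := Subsingleton.elim _ _
    rw [h1]
  have htw : ∀ q : RectPlaquette (fun _ : Fin 2 => 1), su2PlaquetteTwist {p} q = su2MinusOne := fun q => by
    unfold su2PlaquetteTwist
    rw [if_pos (Finset.mem_singleton.2 (hall q))]
  unfold rectMagSumTw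
  simp only [htw, Pi.one_apply, one_mul, su2_trace_re_su2MinusOne_mul, Finset.sum_neg_distrib]

/-- **`Var M_S = Var M₁` on the one-site `2`-torus** (`M_S = −M₁`). [folklore] -/
theorem su2_variance_rectMagSumTw_twist_eq_oneSite_two (p : RectPlaquette (fun _ : Fin 2 => 1)) :
    ∫ a, (rectMagSumTw (fundamentalRep (Fin 2)) (su2PlaquetteTwist {p}) a -
        ∫ b, rectMagSumTw (fundamentalRep (Fin 2)) (su2PlaquetteTwist {p}) b
          ∂(rectSliceMeasure (Matrix.specialUnitaryGroup (Fin 2) ℂ) (fun _ : Fin 2 => 1))) ^ 2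
        ∂(rectSliceMeasure (Matrix.specialUnitaryGroup (Fin 2) ℂ) (fun _ : Fin 2 => 1)) =
      ∫ a, (rectMagSumTw (fundamentalRep (Fin 2)) 1 a -
        ∫ b, rectMagSumTw (fundamentalRep (Fin 2)) 1 b
          ∂(rectSliceMeasure (Matrix.specialUnitaryGroup (Fin 2) ℂ) (fun _ : Fin 2 => 1))) ^ 2
        ∂(rectSliceMeasure (Matrix.specialUnitaryGroup (Fin 2) ℂ) (fun _ : Fin 2 => 1)) := by
  simp_rw [rectMagSumTw_twist_eq_neg_oneSite_two p]
  rw [integral_neg]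
  refine integral_congr_ae (ae_of_all _ fun a => ?_)
  ring

/-- **THE `d = 3` ONE-SITE MAGNETIC-FLUX ENERGY HAS NO `β²` TERM**: for the one-site `2`-torus and one twisted plaquette,
`|E_mag(β; 1²; {p}) − β/2| ≤ 200 (5|β|)³` whenever `|β| ≤ 1/40` (`3#P + N = 5`).  First order `½` (as in
`abs_su2RectMagneticFluxEnergy_oneSite_sub_le`), second order ZERO — the FLOW-TABLE's `d = 3` `1x1` magnetic cells indeed read
`(E_mag − β/2)/β³ ≈ −0.0208` at `β = ¼ … 3/2` with no quadratic component. [cite: tHooft1979Flux] -/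
theorem abs_su2RectMagneticFluxEnergy_oneSite_two_sub_le (β : ℝ) (p : RectPlaquette (fun _ : Fin 2 => 1))
    (hβ : |β| ≤ 1 / 40) :
    |su2RectMagneticFluxEnergy β (fun _ : Fin 2 => 1) {p} - β / 2| ≤ 200 * (5 * |β|) ^ 3 := by
  have hcard : (3 * (Fintype.card (RectTorusSite (fun _ : Fin 2 => 1)) * Fintype.card {q : Fin 2 × Fin 2 // q.1 < q.2}) +
      Fintype.card (RectTorusSite (fun _ : Fin 2 => 1) × Fin 2) : ℝ) = 5 := by
    have h1 : Fintype.card (RectTorusSite (fun _ : Fin 2 => 1)) = 1 := by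
      rw [Fintype.card_eq_one_iff]; exact ⟨fun _ => 0, fun x => Subsingleton.elim _ _⟩
    have h2 : Fintype.card {q : Fin 2 × Fin 2 // q.1 < q.2} = 1 := by decide
    rw [Fintype.card_prod, h1, h2, Fintype.card_fin]
    norm_num
  have hβ' : |β| * (3 * (Fintype.card (RectTorusSite (fun _ : Fin 2 => 1)) * Fintype.card {q : Fin 2 × Fin 2 // q.1 < q.2}) +
      Fintype.card (RectTorusSite (fun _ : Fin 2 => 1) × Fin 2)) ≤ 1 / 8 := by
    rw [hcard]; linarith [abs_nonneg β]
  have h := abs_su2RectMagneticFluxEnergy_sub_secondOrder_le β (fun _ : Fin 2 => 1) {p} hβ'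
  rw [hcard, su2_integral_rectMagSumTw_one_sub_oneSite {p}, su2_variance_rectMagSumTw_twist_eq_oneSite_two p, sub_self,
    mul_zero, add_zero, Finset.card_singleton, Nat.cast_one, mul_one] at h
  rw [show |β| * 5 = 5 * |β| by ring] at h
  exact h

end OneSite

end Summit.Ventures.YMGap.FlowData
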